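import Literature.NumberTheory.EllipticCurves.X049TwistMinimalModelProofs
import Literature.NumberTheory.EllipticCurves.Cm7QuadraticTwistGoodAtTwo
import Literature.NumberTheory.EllipticCurves.PadicSigmaSqVariableChangeProofs
import Literature.NumberTheory.EllipticCurves.CanonicalPAdicHeightParallelogramProofs
import Literature.NumberTheory.EllipticCurves.CanonicalPAdicHeightThetaProofs
import Literature.NumberTheory.EllipticCurves.GlobalMinimalModel
import HarnessLib

/-!
# A Mazur–Tate sigma-squared pair at `2` on EVERY globally minimal model of `49a1^{(d)}`, `d ≡ 1 (mod 4)`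
# squarefree (proofs only)

Topic `NumberTheory/EllipticCurves` (theorems only; no definition, no named fact, no `sorry`). Written by the
width seat `bsd-line-cf2-p1-w8` (g27) of the cell `bsd-print-cf2` as the MODEL-FREE socket for the hypothesis
`∃ Sq c, (V.baseChange ℚ_[2]).IsMazurTateSigmaSqPair Sq c` of the nine-print ticket
`Summit.….Theorems.PrintCf2.DisegniPairTwo.disegniGZ_pair_two_of_nine_prints` (road (C) `disegni-pair-two`,
crux stmt-BirchSwinnertonDyer-20368), in the currency the line's frame hands over — «`V` globally minimal,
`C • V = 49a1^{(d)}`, `d ≡ 1 (mod 4)` squarefree» — exactly parallel to the tree's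
`isOrdinaryAt_two_of_cm7_quadraticTwist` (Summits) / `cm7_quadraticTwist_hasGoodReductionAtPrime_two`.

## The statement and its proof

`exists_isMazurTateSigmaSqPair_two_of_cm7_quadraticTwist`: for `d = 4k + 1` squarefree and `A/ℚ` globally
minimal elliptic with `C • A = cm7.quadraticTwist d` for some change of variables `C`, the base change
`A ⊗ ℚ₂` carries a Mazur–Tate sigma-squared pair (`WeierstrassCurve.IsMazurTateSigmaSqPair`). Proof, all
inputs tree theorems: `D := (1, 0, ½, 0)·C` carries `A` to the integral model
`W_k = [1, −(3k+1), 0, −2d², −d³]` (`cm7_quadraticTwist_smul_eq`); `W_k` is globally minimal for squarefree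
`d` (`cm7Twist_isGloballyMinimal_of_squarefree`), so by uniqueness of the global minimal model
(`isGloballyMinimal_unique_holds`: Silverman *AEC* VII.1.3(b) + VIII.8.3) `D.u = ±1` and `D.r, D.s, D.t ∈ ℤ`;
`W_k ⊗ ℚ₂` carries the pair `(σ_CM², 0)` (`cm7Twist_exists_isMazurTateSigmaSqPair_two`, Perrin-Riou 1984
Ch. III §1.2 Lemme 2); and a sigma-squared pair transports back along the `2`-integral change of variables
`D ⊗ ℚ₂` (`exists_isMazurTateSigmaSqPair_of_variableChange`, Mazur–Tate 1991 §3 / MST 2006 Thm. 1.3).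
BSD is not proved by any of this.

## References
* [Perrin-Riou 1984] Ch. III §1.2 Lemme 2 («invariance par rapport au modèle»). [cite: Perrinriou1984, Ch. III §1.2 Lemme 2]
* [Mazur–Stein–Tate 2006] Thm. 1.3, §2.7. [cite: MazurSteinTate2006, Thm. 1.3]
* [Silverman 2009] *AEC*, Prop. VII.1.3(b), VIII.8.3, X.5. [cite: SilvermanAEC2009, Prop. VII.1.3(b)]
-/

noncomputable section

open WeierstrassCurve

namespace Literature.NumberTheory.EllipticCurves

/-- **A sigma-squared pair at `2` on every globally minimal model of `49a1^{(d)}`, `d ≡ 1 (mod 4)` squarefree.**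
For `A/ℚ` elliptic and globally minimal with `C • A = cm7.quadraticTwist d` (`d % 4 = 1`, `d` squarefree):
`∃ Sq c, (A ⊗ ℚ₂).IsMazurTateSigmaSqPair Sq c`. Via the integral model `W_k` (`d = 4k+1`), uniqueness of the
global minimal model (`u = ±1`, `r, s, t ∈ ℤ`) and transport of sigma-squared pairs along `2`-integral changes of
variables. [cite: Perrinriou1984, Ch. III §1.2 Lemme 2] [cite: MazurSteinTate2006, Thm. 1.3]
[cite: SilvermanAEC2009, Prop. VII.1.3(b) and VIII.8.3] -/
theorem exists_isMazurTateSigmaSqPair_two_of_cm7_quadraticTwist {d : ℤ} (hd : d % 4 = 1) (hsq : Squarefree d)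
    (A : WeierstrassCurve ℚ) [A.IsElliptic] [A.IsGloballyMinimal] (C : VariableChange ℚ)
    (hC : C • A = cm7.quadraticTwist (d : ℚ)) :
    ∃ Sq : PowerSeries ℚ_[2], ∃ c : ℚ_[2], (A.baseChange ℚ_[2]).IsMazurTateSigmaSqPair Sq c := by
  haveI : Fact (Nat.Prime 2) := ⟨Nat.prime_two⟩
  obtain ⟨k, rfl⟩ : ∃ k : ℤ, d = 4 * k + 1 := ⟨d / 4, by omega⟩
  set Wk : WeierstrassCurve ℚ :=
    ⟨1, -(3 * (k : ℚ) + 1), 0, -2 * (4 * (k : ℚ) + 1) ^ 2, -(4 * (k : ℚ) + 1) ^ 3⟩ with hWk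
  set D : VariableChange ℚ := (⟨1, 0, 1 / 2, 0⟩ : VariableChange ℚ) * C with hD
  -- `D • A = W_k`
  have hDA : D • A = Wk := by
    rw [hD, mul_smul, hC, cm7_quadraticTwist_smul_eq k, hWk]
    ext <;> simp [WeierstrassCurve.map]
  -- `W_k` is globally minimal, hence `D.u = ±1`, `D.r, D.s, D.t ∈ ℤ`
  have hWkmin : Wk.IsGloballyMinimal := cm7Twist_isGloballyMinimal_of_squarefree Wk k hWk hsq
  haveI : (D • A).IsGloballyMinimal := by rw [hDA]; exact hWkmin
  obtain ⟨hu, r, s, t, hr, hs, ht⟩ := isGloballyMinimal_unique_holds A D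
  -- the pair of `W_k ⊗ ℚ₂`, read on `(D ⊗ ℚ₂) • (A ⊗ ℚ₂)`
  have hbc : (D.baseChange ℚ_[2]) • (A.baseChange ℚ_[2]) = (D • A).baseChange ℚ_[2] := by
    rw [VariableChange.baseChange, WeierstrassCurve.baseChange, WeierstrassCurve.baseChange, map_variableChange]
  have hex : ∃ Sq' : PowerSeries ℚ_[2], ∃ c' : ℚ_[2],
      ((D.baseChange ℚ_[2]) • (A.baseChange ℚ_[2])).IsMazurTateSigmaSqPair Sq' c' := by
    rw [hbc, hDA]
    exact cm7Twist_exists_isMazurTateSigmaSqPair_two Wk k hWk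
  -- `2`-integrality of `D ⊗ ℚ₂`
  have hu' : ‖((D.baseChange ℚ_[2]).u : ℚ_[2])‖ = 1 := by
    rw [VariableChange.baseChange, VariableChange.map_u, Units.coe_map, MonoidHom.coe_coe]
    rcases hu with h | h <;> simp [h]
  have hr' : ‖(D.baseChange ℚ_[2]).r‖ ≤ 1 := by
    rw [VariableChange.baseChange, VariableChange.map_r, hr, map_intCast]
    exact Padic.norm_int_le_one r
  have hs' : ‖(D.baseChange ℚ_[2]).s‖ ≤ 1 := by
    rw [VariableChange.baseChange, VariableChange.map_s, hs, map_intCast]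
    exact Padic.norm_int_le_one s
  have ht' : ‖(D.baseChange ℚ_[2]).t‖ ≤ 1 := by
    rw [VariableChange.baseChange, VariableChange.map_t, ht, map_intCast]
    exact Padic.norm_int_le_one t
  exact exists_isMazurTateSigmaSqPair_of_variableChange hu' hr' hs' ht' hex

end Literature.NumberTheory.EllipticCurves

end
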